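import Summits.QuantumFields.YangMills.Theorems.UnitScaleTiltProp8HalvingDressingLetterChartOfRecordWindow
import Summits.QuantumFields.YangMills.Theorems.UnitScaleTiltProp8HalvingDressingLetterFlatScaledAllSizes
import HarnessLib

/-!
# Route `UnitScaleTilt`, crux K1 child «MinimiserStabilityRegPr» (stmt-QuantumFields-19200), registered stub V2′ `stub_halvingStep`
# (skeleton v10 `BirthV10`) — **(P2-small) α7: THE C_E KNIT ON THE CHART OF RECORD FOR EVERY TORUS SIZE** — ✓ p616882 FILE E
# `exists_hWq_dressed_cubeSeq_T3_chartOfRecord` and ✓ p618497 FILE E v2 `…_ofKernelRow` RE-INSTANTIATED on the α6 ports (✓ `FlatPortAllSizes.hSupFlatH_of_adm22_allSizes`,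
# ★w7-19200 g0; the α7 H-side twins `hLetters_flatHs_allSizes`∕`hX1_flatHs_allSizes` of `…FlatScaledAllSizes`): the torus-size binder `a′ + 3 ≤ m + n` DELETED, nothing else
# changes (★★OWNER RULINGS g26-№16∕№18, ACK 31 (2))

Cell `ym3-torus` (HUMAN RULING D-0037, YM ladder rung R3 — continuum SU(2) YM₃ on the torus is a RUNG, not the Clay problem), width seat `ym-ust-19200-w6`
(D-0154 (3c)).  `--supports stmt-QuantumFields-19200 --as helper`; count-neutral; def-free, 0 sorry, standard axioms.

WHAT THIS FILE PROVES (sorry-free; no definition; statements = the originals VERBATIM minus `(_ : a' + 3 ≤ m + n)`):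
★★★ `exists_hWq_dressed_cubeSeq_T3_chartOfRecord_allSizes` (census S7 + S10 on the chart of record: `Hs`, `Dsel`, P3b's `W₀`, the dressed (98) letter; displayed =
(X2-C′)♭ ball letter + numeric windows) and ★★★ `exists_hWq_dressed_cubeSeq_T3_chartOfRecord_ofKernelRow_allSizes` (window supplied by ✓`exists_CE_window`, (X2-C′)♭ read
from the (157)♭ read-kernel row on an `R′`-ball via ✓ p616686) — for EVERY member `m ≥ 1` and height `1 ≤ K − n`, `K − n + 1 ≤ m + K`.
HONEST SCOPE.  Supplier swap only (B3, the carrier, `exists_flatH_scaledExt_hHinv`, `hCcolFlatBall_of_readKernel157`, FILE C were size-free already).  The L-floor `4 ≤ ℓ`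
(LF-1) is still threaded.  NOT a claim about the stub, the crux, the rung or the mass gap; no summit statement is proved by this seat.

References: T. Bałaban, CMP **102** (1985) 277–309 [Balaban1985Variational] (44)–(50) p.285, (55) p.286, (72)–(73) p.289, (80)–(89) pp.290–291, Prop. 4 (97)–(98)
pp.292–293, (144) p.300, (152)–(158) pp.301–302, (161)–(163) p.303; CMP **98** (1985) 17–51 [Balaban1985Averaging] Prop. 5 (156)–(157) p.42.
-/

set_option autoImplicit false

noncomputable section

open scoped BigOperators Matrix Matrix.Norms.L2Operator
open NormedSpace Filter Topology

namespace Summit.QuantumFields.YangMills.Theorems.HalvingDressingLetter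

open Literature.MathematicalPhysics.QuantumFieldTheory.Balaban1983to89
open B6GlobalChartV1 (PV)
open B6SectADomainsV1 (Domains)
open B6SectAOperatorsV1 (BondIdx)
open B5Eq118OneStroke (iterBlockOf)
open T3ContinuumYM3Torus (T3Family)
open FlatCubeOpsText (Adm22 IsLevWeight HSupLetterG)
open FlatOpsLettersAssembly (flatH levWeight_nonneg)
open FlatCubeSequenceAligned (cubeSeqMT3 cubeSeqMT3_k)
open FlatCubeSequenceAdm (adm22_cubeSeqMT3)
open FlatHDressingShape (exists_flatH_scaledExt_hHinv)
open Prop8ChartDoubleBar (chartLogFlat chartRemainderFlat_hCd_hCq_B1)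
open Chart47AnalyticCarrier (exists_analytic_chartD_of_remainder_T3)
open ChartRemainderColumnLetterFlat (hCcolFlatBall_of_readKernel157)
open FlatPortAllSizes (hSupFlatH_of_adm22_allSizes)

/-- `1 ≤ 3` (named once; every `PV` below carries the same proof term). [folklore] -/
private theorem hd3 : 1 ≤ 2 + 1 := by norm_num

/-! ## §1 FILE E, all torus sizes -/

-- heartbeat budget (HOME README rule): FILE E-sized signature (> 100 lines); budgeted 400k on this declaration only
set_option maxHeartbeats 400000 in
/-- ★★★ **THE DRESSING LETTER `C_E` ON THE CHART OF RECORD, ALL TORUS SIZES** ((P2-small) α7 twin of ✓`exists_hWq_dressed_cubeSeq_T3_chartOfRecord`: binder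
`a′ + 3 ≤ m + n` deleted; suppliers := `hLetters_flatHs_allSizes`, `hX1_flatHs_allSizes`, ✓`FlatPortAllSizes.hSupFlatH_of_adm22_allSizes` for `Hs`; B3, the carrier,
`exists_flatH_scaledExt_hHinv`, §1 of FILE E and FILE C unchanged): `H := Hs`, `C := C♭`, `D := Dsel`, the four H-side letters, (55), (49), the differentiabilities
discharged; displayed: the (X2-C′)♭ ball letter and the numeric windows; output block as FILE E.
[cite: Balaban1985Variational, (44)-(50) p.285, (55) p.286, (72)-(73) p.289, (80)-(89) pp.290-291, Prop. 4 (97)-(98) pp.292-293, (144) p.300, (152)-(158) pp.301-302, (161)-(163) p.303; Balaban1985Averaging, Prop. 5 (157) p.42] -/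
theorem exists_hWq_dressed_cubeSeq_T3_chartOfRecord_allSizes (ℓ : ℕ) (hL : Odd (ℓ + 1) ∧ 1 < ℓ + 1) (hℓ : 4 ≤ ℓ) :
    ∃ (Mh₀ R₀ : ℕ) (BH CX K₀ CP : ℝ), 0 ≤ BH ∧ 0 ≤ CX ∧ 0 ≤ K₀ ∧ 0 ≤ CP ∧
    ∀ (m : ℕ) (hm : 1 ≤ m) (n K : ℕ) (_ : 1 ≤ K - n) (_ : K - n + 1 ≤ m + K) {Mh R a' : ℕ} (_ : Mh = (ℓ + 1) ^ a') (_ : Mh₀ ≤ Mh) (_ : R₀ ≤ R)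
      (x₀ : Site (PV 2 ℓ m K hd3 hL) 0) (ρ S : ℕ) (hM : 1 ≤ (ℓ + 1) * Mh) (_ : R * ((ℓ + 1) * Mh) ≤ S)
      (w : ℕ → PBond (PV 2 ℓ m K hd3 hL) 0 → ℝ) (_ : IsLevWeight (⟨ℓ + 1, hL, m, hm⟩ : T3Family) n K (cubeSeqMT3 (⟨ℓ + 1, hL, m, hm⟩ : T3Family) n K x₀ ρ S ((ℓ + 1) * Mh) hM) w)
      (u : BondIdx (cubeSeqMT3 (⟨ℓ + 1, hL, m, hm⟩ : T3Family) n K x₀ ρ S ((ℓ + 1) * Mh) hM) → ℝ) (_ : ∀ c, ((((ℓ + 1 : ℕ) : ℝ)) ^ (K - n)) ^ 3 * ((((ℓ + 1 : ℕ) : ℝ)) ^ (c.1.1 : ℕ) * ((((ℓ + 1 : ℕ) : ℝ))⁻¹) ^ (K - n))⁻¹ ≤ u c)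
      {ε C₃ R' Rc₀ a₃ : ℝ} (_ : 0 < ε) (_ : 3 * ε ≤ (16 * 3800 * (((((PV 2 ℓ m K hd3 hL)).d + 2) * ((PV 2 ℓ m K hd3 hL)).L : ℕ) : ℝ) ^ 2 * ((ℓ + 1 : ℕ) : ℝ))⁻¹ / 4) (_ : 9 * (64 * ((ℓ + 1 : ℕ) : ℝ) / (16 * 3800 * (((((PV 2 ℓ m K hd3 hL)).d + 2) * ((PV 2 ℓ m K hd3 hL)).L : ℕ) : ℝ) ^ 2 * ((ℓ + 1 : ℕ) : ℝ))⁻¹) * BH * ε < 1)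
      (_ : 0 ≤ C₃) (_ : (1 + 4 * BH * (64 * ((ℓ + 1 : ℕ) : ℝ) / (16 * 3800 * (((((PV 2 ℓ m K hd3 hL)).d + 2) * ((PV 2 ℓ m K hd3 hL)).L : ℕ) : ℝ) ^ 2 * ((ℓ + 1 : ℕ) : ℝ))⁻¹) * ε) * ε ≤ R')
      (_ : ∀ (Z : PBond (PV 2 ℓ m K hd3 hL) 0 → Matrix (Fin 2) (Fin 2) ℂ) (ρ' : ℝ), ρ' < R' → (∀ b, w 1 b * ‖Z b‖ ≤ ρ') →
        ∀ δ : PBond (PV 2 ℓ m K hd3 hL) 0 → Matrix (Fin 2) (Fin 2) ℂ,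
          ∑ c, u c * ‖fderiv ℂ (fun A : PBond (PV 2 ℓ m K hd3 hL) 0 → Matrix (Fin 2) (Fin 2) ℂ => chartLogFlat (((((ℓ + 1 : ℕ) : ℝ))⁻¹) ^ (K - n)) (cubeSeqMT3 (⟨ℓ + 1, hL, m, hm⟩ : T3Family) n K x₀ ρ S ((ℓ + 1) * Mh) hM) A - fderiv ℂ (chartLogFlat (((((ℓ + 1 : ℕ) : ℝ))⁻¹) ^ (K - n)) (cubeSeqMT3 (⟨ℓ + 1, hL, m, hm⟩ : T3Family) n K x₀ ρ S ((ℓ + 1) * Mh) hM) : (PBond (PV 2 ℓ m K hd3 hL) 0 → Matrix (Fin 2) (Fin 2) ℂ) → BondIdx (cubeSeqMT3 (⟨ℓ + 1, hL, m, hm⟩ : T3Family) n K x₀ ρ S ((ℓ + 1) * Mh) hM) → Matrix (Fin 2) (Fin 2) ℂ) 0 A) Z δ c‖ ≤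
            C₃ * ρ' * ∑ b, (w 3 b)⁻¹ * ‖δ b‖)
      (_ : C₃ * (1 + 4 * BH * (64 * ((ℓ + 1 : ℕ) : ℝ) / (16 * 3800 * (((((PV 2 ℓ m K hd3 hL)).d + 2) * ((PV 2 ℓ m K hd3 hL)).L : ℕ) : ℝ) ^ 2 * ((ℓ + 1 : ℕ) : ℝ))⁻¹) * ε) * ε * K₀ ≤ 1 / 2) (_ : 0 ≤ Rc₀) (_ : Rc₀ < ε) (_ : a₃ ≤ Rc₀)
      (_ : (1 + 4 * BH * (64 * ((ℓ + 1 : ℕ) : ℝ) / (16 * 3800 * (((((PV 2 ℓ m K hd3 hL)).d + 2) * ((PV 2 ℓ m K hd3 hL)).L : ℕ) : ℝ) ^ 2 * ((ℓ + 1 : ℕ) : ℝ))⁻¹) * Rc₀) * a₃ ≤ 1 / (2 * ((ℓ + 1 : ℕ) : ℝ))),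
    ∃ (Hs : (BondIdx (cubeSeqMT3 (⟨ℓ + 1, hL, m, hm⟩ : T3Family) n K x₀ ρ S ((ℓ + 1) * Mh) hM) → Matrix (Fin 2) (Fin 2) ℂ) →ₗ[ℂ] (PBond (PV 2 ℓ m K hd3 hL) 0 → Matrix (Fin 2) (Fin 2) ℂ))
      (Dsel : (PBond (PV 2 ℓ m K hd3 hL) 0 → Matrix (Fin 2) (Fin 2) ℂ) → BondIdx (cubeSeqMT3 (⟨ℓ + 1, hL, m, hm⟩ : T3Family) n K x₀ ρ S ((ℓ + 1) * Mh) hM) → Matrix (Fin 2) (Fin 2) ℂ)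
      (W₀ : (PBond (PV 2 ℓ m K hd3 hL) 0 → Matrix (Fin 2) (Fin 2) ℂ) → (PBond (PV 2 ℓ m K hd3 hL) 0 → Matrix (Fin 2) (Fin 2) ℂ)),
      (∀ (X : BondIdx (cubeSeqMT3 (⟨ℓ + 1, hL, m, hm⟩ : T3Family) n K x₀ ρ S ((ℓ + 1) * Mh) hM) → Matrix (Fin 2) (Fin 2) ℂ) (b : PBond (PV 2 ℓ m K hd3 hL) 0),
        Hs X b = ∑ c : BondIdx (cubeSeqMT3 (⟨ℓ + 1, hL, m, hm⟩ : T3Family) n K x₀ ρ S ((ℓ + 1) * Mh) hM), (flatH (⟨ℓ + 1, hL, m, hm⟩ : T3Family) n K (cubeSeqMT3 (⟨ℓ + 1, hL, m, hm⟩ : T3Family) n K x₀ ρ S ((ℓ + 1) * Mh) hM) (Pi.single c 1) b * ((((ℓ + 1 : ℕ) : ℝ)) ^ (c.1.1 : ℕ) * ((((ℓ + 1 : ℕ) : ℝ))⁻¹) ^ (K - n))⁻¹) • X c) ∧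
      (∀ X : BondIdx (cubeSeqMT3 (⟨ℓ + 1, hL, m, hm⟩ : T3Family) n K x₀ ρ S ((ℓ + 1) * Mh) hM) → Matrix (Fin 2) (Fin 2) ℂ, (fderiv ℂ (chartLogFlat (((((ℓ + 1 : ℕ) : ℝ))⁻¹) ^ (K - n)) (cubeSeqMT3 (⟨ℓ + 1, hL, m, hm⟩ : T3Family) n K x₀ ρ S ((ℓ + 1) * Mh) hM) : (PBond (PV 2 ℓ m K hd3 hL) 0 → Matrix (Fin 2) (Fin 2) ℂ) → BondIdx (cubeSeqMT3 (⟨ℓ + 1, hL, m, hm⟩ : T3Family) n K x₀ ρ S ((ℓ + 1) * Mh) hM) → Matrix (Fin 2) (Fin 2) ℂ) 0) (Hs X) = X) ∧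
      (∀ (X : BondIdx (cubeSeqMT3 (⟨ℓ + 1, hL, m, hm⟩ : T3Family) n K x₀ ρ S ((ℓ + 1) * Mh) hM) → Matrix (Fin 2) (Fin 2) ℂ) (t : ℝ), (∀ c, ‖X c‖ ≤ t) →
        (∀ b, w 1 b * ‖Hs X b‖ ≤ BH * t) ∧
        ∀ (b : PBond (PV 2 ℓ m K hd3 hL) 0) (ν : Fin 3), w 2 b * ((ℓ + 1 : ℕ) : ℝ) ^ (K - n) * ‖Hs X ⟨b.src.shift ν, b.dir⟩ - Hs X b‖ ≤ BH * t) ∧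
      AnalyticOnNhd ℂ Dsel {A' : PBond (PV 2 ℓ m K hd3 hL) 0 → Matrix (Fin 2) (Fin 2) ℂ | ∀ b, w 1 b * ‖A' b‖ < ε} ∧
      DifferentiableOn ℂ (fderiv ℂ Dsel) {A' : PBond (PV 2 ℓ m K hd3 hL) 0 → Matrix (Fin 2) (Fin 2) ℂ | ∀ b, w 1 b * ‖A' b‖ < ε} ∧
      (∀ A' : PBond (PV 2 ℓ m K hd3 hL) 0 → Matrix (Fin 2) (Fin 2) ℂ, (∀ b, w 1 b * ‖A' b‖ < ε) →
        (∀ c, ‖Dsel A' c‖ ≤ 4 * (64 * ((ℓ + 1 : ℕ) : ℝ) / (16 * 3800 * (((((PV 2 ℓ m K hd3 hL)).d + 2) * ((PV 2 ℓ m K hd3 hL)).L : ℕ) : ℝ) ^ 2 * ((ℓ + 1 : ℕ) : ℝ))⁻¹) * ε ^ 2) ∧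
        chartLogFlat (((((ℓ + 1 : ℕ) : ℝ))⁻¹) ^ (K - n)) (cubeSeqMT3 (⟨ℓ + 1, hL, m, hm⟩ : T3Family) n K x₀ ρ S ((ℓ + 1) * Mh) hM) (A' - Hs (Dsel A')) - (fderiv ℂ (chartLogFlat (((((ℓ + 1 : ℕ) : ℝ))⁻¹) ^ (K - n)) (cubeSeqMT3 (⟨ℓ + 1, hL, m, hm⟩ : T3Family) n K x₀ ρ S ((ℓ + 1) * Mh) hM) : (PBond (PV 2 ℓ m K hd3 hL) 0 → Matrix (Fin 2) (Fin 2) ℂ) → BondIdx (cubeSeqMT3 (⟨ℓ + 1, hL, m, hm⟩ : T3Family) n K x₀ ρ S ((ℓ + 1) * Mh) hM) → Matrix (Fin 2) (Fin 2) ℂ) 0) (A' - Hs (Dsel A')) = Dsel A' ∧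
        chartLogFlat (((((ℓ + 1 : ℕ) : ℝ))⁻¹) ^ (K - n)) (cubeSeqMT3 (⟨ℓ + 1, hL, m, hm⟩ : T3Family) n K x₀ ρ S ((ℓ + 1) * Mh) hM) (A' - Hs (Dsel A')) = (fderiv ℂ (chartLogFlat (((((ℓ + 1 : ℕ) : ℝ))⁻¹) ^ (K - n)) (cubeSeqMT3 (⟨ℓ + 1, hL, m, hm⟩ : T3Family) n K x₀ ρ S ((ℓ + 1) * Mh) hM) : (PBond (PV 2 ℓ m K hd3 hL) 0 → Matrix (Fin 2) (Fin 2) ℂ) → BondIdx (cubeSeqMT3 (⟨ℓ + 1, hL, m, hm⟩ : T3Family) n K x₀ ρ S ((ℓ + 1) * Mh) hM) → Matrix (Fin 2) (Fin 2) ℂ) 0) A' ∧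
        (∀ D' : BondIdx (cubeSeqMT3 (⟨ℓ + 1, hL, m, hm⟩ : T3Family) n K x₀ ρ S ((ℓ + 1) * Mh) hM) → Matrix (Fin 2) (Fin 2) ℂ, (∀ c, ‖D' c‖ ≤ 4 * (64 * ((ℓ + 1 : ℕ) : ℝ) / (16 * 3800 * (((((PV 2 ℓ m K hd3 hL)).d + 2) * ((PV 2 ℓ m K hd3 hL)).L : ℕ) : ℝ) ^ 2 * ((ℓ + 1 : ℕ) : ℝ))⁻¹) * ε ^ 2) →
          chartLogFlat (((((ℓ + 1 : ℕ) : ℝ))⁻¹) ^ (K - n)) (cubeSeqMT3 (⟨ℓ + 1, hL, m, hm⟩ : T3Family) n K x₀ ρ S ((ℓ + 1) * Mh) hM) (A' - Hs D') - (fderiv ℂ (chartLogFlat (((((ℓ + 1 : ℕ) : ℝ))⁻¹) ^ (K - n)) (cubeSeqMT3 (⟨ℓ + 1, hL, m, hm⟩ : T3Family) n K x₀ ρ S ((ℓ + 1) * Mh) hM) : (PBond (PV 2 ℓ m K hd3 hL) 0 → Matrix (Fin 2) (Fin 2) ℂ) → BondIdx (cubeSeqMT3 (⟨ℓ + 1,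 hL, m, hm⟩ : T3Family) n K x₀ ρ S ((ℓ + 1) * Mh) hM) → Matrix (Fin 2) (Fin 2) ℂ) 0) (A' - Hs D') = D' → D' = Dsel A') ∧
        (∀ ρ' : ℝ, 0 ≤ ρ' → (∀ b, w 1 b * ‖A' b‖ ≤ ρ') → ∀ c, ‖Dsel A' c‖ ≤ 4 * (64 * ((ℓ + 1 : ℕ) : ℝ) / (16 * 3800 * (((((PV 2 ℓ m K hd3 hL)).d + 2) * ((PV 2 ℓ m K hd3 hL)).L : ℕ) : ℝ) ^ 2 * ((ℓ + 1 : ℕ) : ℝ))⁻¹) * ρ' ^ 2)) ∧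
      (∀ (Y : PBond (PV 2 ℓ m K hd3 hL) 0 → Matrix (Fin 2) (Fin 2) ℂ) (r : ℝ), r < ε → (∀ b, w 1 b * ‖Y b‖ ≤ r) → (∀ (b : PBond (PV 2 ℓ m K hd3 hL) 0) (ν : Fin 3), w 2 b * ((ℓ + 1 : ℕ) : ℝ) ^ (K - n) * ‖Y ⟨b.src.shift ν, b.dir⟩ - Y b‖ ≤ r) →
        ∀ c, ‖Dsel Y c‖ ≤ 4 * (64 * ((ℓ + 1 : ℕ) : ℝ) / (16 * 3800 * (((((PV 2 ℓ m K hd3 hL)).d + 2) * ((PV 2 ℓ m K hd3 hL)).L : ℕ) : ℝ) ^ 2 * ((ℓ + 1 : ℕ) : ℝ))⁻¹) * r ^ 2) ∧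
      (∀ (Y : PBond (PV 2 ℓ m K hd3 hL) 0 → Matrix (Fin 2) (Fin 2) ℂ) (r : ℝ), r < ε → (∀ b, w 1 b * ‖Y b‖ ≤ r) → (∀ (b : PBond (PV 2 ℓ m K hd3 hL) 0) (ν : Fin 3), w 2 b * ((ℓ + 1 : ℕ) : ℝ) ^ (K - n) * ‖Y ⟨b.src.shift ν, b.dir⟩ - Y b‖ ≤ r) →
        ∀ᶠ X in 𝓝 Y, Dsel X = (fun Z : PBond (PV 2 ℓ m K hd3 hL) 0 → Matrix (Fin 2) (Fin 2) ℂ => chartLogFlat (((((ℓ + 1 : ℕ) : ℝ))⁻¹) ^ (K - n)) (cubeSeqMT3 (⟨ℓ + 1, hL, m, hm⟩ : T3Family) n K x₀ ρ S ((ℓ + 1) * Mh) hM) Z - fderiv ℂ (chartLogFlat (((((ℓ + 1 : ℕ) : ℝ))⁻¹) ^ (K - n)) (cubeSeqMT3 (⟨ℓ + 1, hL, m, hm⟩ : T3Family) n K x₀ ρ S ((ℓ + 1) * Mh) hM) : (PBond (PV 2 ℓ m K hd3 hL) 0 → Matrix (Fin 2) (Fin 2) ℂ) → BondIdx (cubeSeqMT3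 (⟨ℓ + 1, hL, m, hm⟩ : T3Family) n K x₀ ρ S ((ℓ + 1) * Mh) hM) → Matrix (Fin 2) (Fin 2) ℂ) 0 Z) (X - Hs (Dsel X))) ∧
      (∀ (Y : PBond (PV 2 ℓ m K hd3 hL) 0 → Matrix (Fin 2) (Fin 2) ℂ) (r : ℝ), r < ε → (∀ b, w 1 b * ‖Y b‖ ≤ r) → (∀ (b : PBond (PV 2 ℓ m K hd3 hL) 0) (ν : Fin 3), w 2 b * ((ℓ + 1 : ℕ) : ℝ) ^ (K - n) * ‖Y ⟨b.src.shift ν, b.dir⟩ - Y b‖ ≤ r) →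
        DifferentiableAt ℂ Dsel Y) ∧
      (∀ (Y : PBond (PV 2 ℓ m K hd3 hL) 0 → Matrix (Fin 2) (Fin 2) ℂ) (r : ℝ), r < ε → (∀ b, w 1 b * ‖Y b‖ ≤ r) → (∀ (b : PBond (PV 2 ℓ m K hd3 hL) 0) (ν : Fin 3), w 2 b * ((ℓ + 1 : ℕ) : ℝ) ^ (K - n) * ‖Y ⟨b.src.shift ν, b.dir⟩ - Y b‖ ≤ r) →
        DifferentiableAt ℂ (fun Z : PBond (PV 2 ℓ m K hd3 hL) 0 → Matrix (Fin 2) (Fin 2) ℂ => chartLogFlat (((((ℓ + 1 : ℕ) : ℝ))⁻¹) ^ (K - n)) (cubeSeqMT3 (⟨ℓ + 1, hL, m, hm⟩ : T3Family) n K x₀ ρ S ((ℓ + 1) * Mh) hM) Z - fderiv ℂ (chartLogFlat (((((ℓ + 1 : ℕ) : ℝ))⁻¹) ^ (K - n)) (cubeSeqMT3 (⟨ℓ + 1, hL, m, hm⟩ : T3Family) n K x₀ ρ S ((ℓ + 1) * Mh) hM) : (PBond (PV 2 ℓ m K hd3 hL) 0 → Matrix (Fin 2) (Fin 2) ℂ)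 → BondIdx (cubeSeqMT3 (⟨ℓ + 1, hL, m, hm⟩ : T3Family) n K x₀ ρ S ((ℓ + 1) * Mh) hM) → Matrix (Fin 2) (Fin 2) ℂ) 0 Z) (Y - Hs (Dsel Y))) ∧
      (∀ A' : PBond (PV 2 ℓ m K hd3 hL) 0 → Matrix (Fin 2) (Fin 2) ℂ, (∀ b, w 1 b * ‖A' b‖ < ε) → ∀ ρ' : ℝ, 0 ≤ ρ' → (∀ b, w 1 b * ‖A' b‖ ≤ ρ') →
        ∀ (W : PBond (PV 2 ℓ m K hd3 hL) 0 → Matrix (Fin 2) (Fin 2) ℂ) (t : ℝ), 0 ≤ t → (∀ b, w 1 b * ‖W b‖ ≤ t) →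
          ∀ c, ‖fderiv ℂ Dsel A' W c‖ ≤ 9 * (64 * ((ℓ + 1 : ℕ) : ℝ) / (16 * 3800 * (((((PV 2 ℓ m K hd3 hL)).d + 2) * ((PV 2 ℓ m K hd3 hL)).L : ℕ) : ℝ) ^ 2 * ((ℓ + 1 : ℕ) : ℝ))⁻¹) * ρ' * (1 - 9 * (64 * ((ℓ + 1 : ℕ) : ℝ) / (16 * 3800 * (((((PV 2 ℓ m K hd3 hL)).d + 2) * ((PV 2 ℓ m K hd3 hL)).L : ℕ) : ℝ) ^ 2 * ((ℓ + 1 : ℕ) : ℝ))⁻¹) * BH * ε)⁻¹ * t) ∧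
      (∀ A δ : PBond (PV 2 ℓ m K hd3 hL) 0 → Matrix (Fin 2) (Fin 2) ℂ, fderiv ℂ (fun A : PBond (PV 2 ℓ m K hd3 hL) 0 → Matrix (Fin 2) (Fin 2) ℂ => (∑ p : Plaq (PV 2 ℓ m K hd3 hL) 0, (1 - (2 : ℂ)⁻¹ * Matrix.trace (exp ((Complex.I * ((((((ℓ + 1 : ℕ) : ℝ)⁻¹) ^ (K - n) : ℝ)) : ℂ)) • A ⟨p.src, p.μ⟩) * exp ((Complex.I * ((((((ℓ + 1 : ℕ) : ℝ)⁻¹) ^ (K - n) : ℝ)) : ℂ)) • A ⟨p.src.shift p.μ, p.ν⟩) * exp (-((Complex.I * ((((((ℓ + 1 : ℕ) : ℝ)⁻¹) ^ (K - n) : ℝ)) : ℂ)) • A ⟨p.src.shift p.ν, p.μ⟩)) * exp (-((Complex.I * ((((((ℓ + 1 : ℕ) : ℝ)⁻¹) ^ (K - n) : ℝ)) : ℂ)) • A ⟨p.src, p.ν⟩))) + (2 : ℂ)⁻¹ * Matrix.trace (((Complex.I * ((((((ℓ + 1 : ℕ) : ℝ)⁻¹) ^ (K - n) : ℝ)) :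 ℂ)) • A ⟨p.src, p.μ⟩) + ((Complex.I * ((((((ℓ + 1 : ℕ) : ℝ)⁻¹) ^ (K - n) : ℝ)) : ℂ)) • A ⟨p.src.shift p.μ, p.ν⟩) + (-((Complex.I * ((((((ℓ + 1 : ℕ) : ℝ)⁻¹) ^ (K - n) : ℝ)) : ℂ)) • A ⟨p.src.shift p.ν, p.μ⟩)) + (-((Complex.I * ((((((ℓ + 1 : ℕ) : ℝ)⁻¹) ^ (K - n) : ℝ)) : ℂ)) • A ⟨p.src, p.ν⟩))) + (4 : ℂ)⁻¹ * Matrix.trace ((((Complex.I * ((((((ℓ + 1 : ℕ) : ℝ)⁻¹) ^ (K - n) : ℝ)) : ℂ)) • A ⟨p.src, p.μ⟩) + ((Complex.I * ((((((ℓ + 1 : ℕ) : ℝ)⁻¹) ^ (K - n) : ℝ)) : ℂ)) • A ⟨p.src.shift p.μ, p.ν⟩) + (-((Complex.I * ((((((ℓ + 1 : ℕ) : ℝ)⁻¹) ^ (K - n) : ℝ)) : ℂ)) • A ⟨p.src.shift p.ν, p.μ⟩)) + (-((Complex.I * ((((((ℓ + 1 : ℕ) : ℝ)⁻¹) ^ (K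 - n) : ℝ)) : ℂ)) • A ⟨p.src, p.ν⟩))) ^ 2)))) A δ =
        (((((ℓ + 1 : ℕ) : ℝ)⁻¹) ^ (K - n) : ℝ) : ℂ) ^ 4 * ∑ b : PBond (PV 2 ℓ m K hd3 hL) 0, Matrix.trace (W₀ A b * δ b)) ∧
      Differentiable ℂ W₀ ∧
      ∀ E : (PBond (PV 2 ℓ m K hd3 hL) 0 → Matrix (Fin 2) (Fin 2) ℂ) → (PBond (PV 2 ℓ m K hd3 hL) 0 → Matrix (Fin 2) (Fin 2) ℂ),
        (∀ (Y : PBond (PV 2 ℓ m K hd3 hL) 0 → Matrix (Fin 2) (Fin 2) ℂ) (b : PBond (PV 2 ℓ m K hd3 hL) 0) (i j : Fin 2), E Y b i j = (((((((ℓ + 1 : ℕ) : ℝ)⁻¹) ^ (K - n)) : ℝ) : ℂ) ^ 4)⁻¹ *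
          (-((((((((ℓ + 1 : ℕ) : ℝ)⁻¹) ^ (K - n)) : ℝ) : ℂ) ^ 2 / 2) * ∑ p : Plaq (PV 2 ℓ m K hd3 hL) 0, Matrix.trace ((Hs (Dsel Y) ⟨p.src, p.μ⟩ + Hs (Dsel Y) ⟨p.src.shift p.μ, p.ν⟩ - Hs (Dsel Y) ⟨p.src.shift p.ν, p.μ⟩ - Hs (Dsel Y) ⟨p.src, p.ν⟩) *
              (((Pi.single b (Matrix.single j i (1 : ℂ)) : PBond (PV 2 ℓ m K hd3 hL) 0 → Matrix (Fin 2) (Fin 2) ℂ)) ⟨p.src, p.μ⟩ + ((Pi.single b (Matrix.single j i (1 : ℂ)) : PBond (PV 2 ℓ m K hd3 hL) 0 → Matrix (Fin 2) (Fin 2) ℂ)) ⟨p.src.shift p.μ, p.ν⟩ -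
                ((Pi.single b (Matrix.single j i (1 : ℂ)) : PBond (PV 2 ℓ m K hd3 hL) 0 → Matrix (Fin 2) (Fin 2) ℂ)) ⟨p.src.shift p.ν, p.μ⟩ - ((Pi.single b (Matrix.single j i (1 : ℂ)) : PBond (PV 2 ℓ m K hd3 hL) 0 → Matrix (Fin 2) (Fin 2) ℂ)) ⟨p.src, p.ν⟩)))
            - (((((((ℓ + 1 : ℕ) : ℝ)⁻¹) ^ (K - n)) : ℝ) : ℂ) ^ 2 / 2) * ∑ p : Plaq (PV 2 ℓ m K hd3 hL) 0, Matrix.trace (((Y - Hs (Dsel Y)) ⟨p.src, p.μ⟩ + (Y - Hs (Dsel Y)) ⟨p.src.shift p.μ, p.ν⟩ - (Y - Hs (Dsel Y)) ⟨p.src.shift p.ν, p.μ⟩ - (Y - Hs (Dsel Y)) ⟨p.src, p.ν⟩) *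
              (Hs (fderiv ℂ Dsel Y (Pi.single b (Matrix.single j i (1 : ℂ)))) ⟨p.src, p.μ⟩ + Hs (fderiv ℂ Dsel Y (Pi.single b (Matrix.single j i (1 : ℂ)))) ⟨p.src.shift p.μ, p.ν⟩ -
                Hs (fderiv ℂ Dsel Y (Pi.single b (Matrix.single j i (1 : ℂ)))) ⟨p.src.shift p.ν, p.μ⟩ - Hs (fderiv ℂ Dsel Y (Pi.single b (Matrix.single j i (1 : ℂ)))) ⟨p.src, p.ν⟩))
            - ((((((ℓ + 1 : ℕ) : ℝ)⁻¹) ^ (K - n)) : ℝ) : ℂ) ^ 4 * ∑ b' : PBond (PV 2 ℓ m K hd3 hL) 0, Matrix.trace (W₀ (Y - Hs (Dsel Y)) b' * Hs (fderiv ℂ Dsel Y (Pi.single b (Matrix.single j i (1 : ℂ)))) b'))) →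
        ∀ (Y : PBond (PV 2 ℓ m K hd3 hL) 0 → Matrix (Fin 2) (Fin 2) ℂ) (r : ℝ), r < a₃ → (∀ b, w 1 b * ‖Y b‖ ≤ r) →
          (∀ (b : PBond (PV 2 ℓ m K hd3 hL) 0) (ν : Fin 3), w 2 b * ((ℓ + 1 : ℕ) : ℝ) ^ (K - n) * ‖Y ⟨b.src.shift ν, b.dir⟩ - Y b‖ ≤ r) →
          ∀ b, w 3 b * ‖(W₀ (Y - Hs (Dsel Y)) + E Y) b‖ ≤
            (12 * (((ℓ + 1 : ℕ) : ℝ) ^ 3 * (1428 + ((ℓ + 1 : ℕ) : ℝ))) * (1 + 4 * BH * (64 * ((ℓ + 1 : ℕ) : ℝ) / (16 * 3800 * (((((PV 2 ℓ m K hd3 hL)).d + 2) * ((PV 2 ℓ m K hd3 hL)).L : ℕ) : ℝ) ^ 2 * ((ℓ + 1 : ℕ) : ℝ))⁻¹) * Rc₀) ^ 2 +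
              (2 * CX * (64 * ((ℓ + 1 : ℕ) : ℝ) / (16 * 3800 * (((((PV 2 ℓ m K hd3 hL)).d + 2) * ((PV 2 ℓ m K hd3 hL)).L : ℕ) : ℝ) ^ 2 * ((ℓ + 1 : ℕ) : ℝ))⁻¹) + 2⁻¹ * (8 * (C₃ * (1 + 4 * BH * (64 * ((ℓ + 1 : ℕ) : ℝ) / (16 * 3800 * (((((PV 2 ℓ m K hd3 hL)).d + 2) * ((PV 2 ℓ m K hd3 hL)).L : ℕ) : ℝ) ^ 2 * ((ℓ + 1 : ℕ) : ℝ))⁻¹) * ε)) * (2 * CP)) * (1 + 4 * BH * (64 * ((ℓ + 1 : ℕ) : ℝ) / (16 * 3800 * (((((PV 2 ℓ m K hd3 hL)).d + 2) * ((PV 2 ℓ m K hd3 hL)).L : ℕ) : ℝ) ^ 2 * ((ℓ + 1 : ℕ) : ℝ))⁻¹) * Rc₀) +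
                (16 * K₀ * (C₃ * (1 + 4 * BH * (64 * ((ℓ + 1 : ℕ) : ℝ) / (16 * 3800 * (((((PV 2 ℓ m K hd3 hL)).d + 2) * ((PV 2 ℓ m K hd3 hL)).L : ℕ) : ℝ) ^ 2 * ((ℓ + 1 : ℕ) : ℝ))⁻¹) * ε))) * Rc₀ * (12 * (((ℓ + 1 : ℕ) : ℝ) ^ 3 * (1428 + ((ℓ + 1 : ℕ) : ℝ)))) * (1 + 4 * BH * (64 * ((ℓ + 1 : ℕ) : ℝ) / (16 * 3800 * (((((PV 2 ℓ m K hd3 hL)).d + 2) * ((PV 2 ℓ m K hd3 hL)).L : ℕ) : ℝ) ^ 2 * ((ℓ + 1 : ℕ) : ℝ))⁻¹) * Rc₀) ^ 2)) * r ^ 2 := by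
  obtain ⟨Mh₁, R₁, BH, K₀, CP, hBH, hK₀, hCP, hletters⟩ := hLetters_flatHs_allSizes ℓ hL hℓ
  obtain ⟨Mh₂, R₂, CX, hCX, hx1⟩ := hX1_flatHs_allSizes ℓ hL hℓ
  obtain ⟨Mh₃, R₃, C, -, hrows⟩ := hSupFlatH_of_adm22_allSizes ℓ hL hℓ
  refine ⟨max (max Mh₁ Mh₂) (max Mh₃ 2), max (max R₁ R₂) (max R₃ (2 * (ℓ + 1))), BH, CX, K₀, CP, hBH, hCX, hK₀, hCP, ?_⟩
  intro m hm n K hk1 hk' Mh R a' hMha hMh hR x₀ ρ S hM hRS w hw u hu ε C₃ R' Rc₀ a₃ hε h3ε hq hC₃ hR' hCcol hsmall hR₀0 hR₀ ha₃ hθ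
  -- thresholds
  have hMh₁ : Mh₁ ≤ Mh := le_trans (le_trans (le_max_left _ _) (le_max_left _ _)) hMh
  have hMh₂ : Mh₂ ≤ Mh := le_trans (le_trans (le_max_right _ _) (le_max_left _ _)) hMh
  have hMh₃ : Mh₃ ≤ Mh := le_trans (le_trans (le_max_left _ _) (le_max_right _ _)) hMh
  have hMh2 : 2 ≤ Mh := le_trans (le_trans (le_max_right _ _) (le_max_right _ _)) hMh
  have hR₁ : R₁ ≤ R := le_trans (le_trans (le_max_left _ _) (le_max_left _ _)) hR
  have hR₂ : R₂ ≤ R := le_trans (le_trans (le_max_right _ _) (le_max_left _ _)) hR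
  have hR₃ : R₃ ≤ R := le_trans (le_trans (le_max_left _ _) (le_max_right _ _)) hR
  have hR2L : 2 * (ℓ + 1) ≤ R := le_trans (le_trans (le_max_right _ _) (le_max_right _ _)) hR
  -- the datum: admissible, top level `K − n`, separations
  have hAdm : Adm22 (cubeSeqMT3 (⟨ℓ + 1, hL, m, hm⟩ : T3Family) n K x₀ ρ S ((ℓ + 1) * Mh) hM) R ((ℓ + 1) * Mh) := adm22_cubeSeqMT3 (⟨ℓ + 1, hL, m, hm⟩ : T3Family) n K x₀ ρ hM hRS
  have hDk : (cubeSeqMT3 (⟨ℓ + 1, hL, m, hm⟩ : T3Family) n K x₀ ρ S ((ℓ + 1) * Mh) hM).k = K - n := cubeSeqMT3_k (⟨ℓ + 1, hL, m, hm⟩ : T3Family) n K x₀ ρ S ((ℓ + 1) * Mh) hM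
  have hS : 2 * ((⟨ℓ + 1, hL, m, hm⟩ : T3Family)).L ≤ S := by
    show 2 * (ℓ + 1) ≤ S
    have hR1 : 1 ≤ R := le_trans (by omega) hR2L
    calc 2 * (ℓ + 1) = 1 * ((ℓ + 1) * 2) := by ring
      _ ≤ R * ((ℓ + 1) * Mh) := Nat.mul_le_mul hR1 (Nat.mul_le_mul_left _ hMh2)
      _ ≤ S := hRS
  have hRL : 2 * ((⟨ℓ + 1, hL, m, hm⟩ : T3Family).P K).L ≤ R := by
    show 2 * (ℓ + 1) ≤ R
    exact hR2L
  -- positivities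
  have hL0 : (0 : ℝ) < ((ℓ + 1 : ℕ) : ℝ) := by positivity
  have hη3 : (0 : ℝ) ≤ ((((ℓ + 1 : ℕ) : ℝ)) ^ (K - n)) ^ 3 := by positivity
  have hlam : ∀ c : BondIdx (cubeSeqMT3 (⟨ℓ + 1, hL, m, hm⟩ : T3Family) n K x₀ ρ S ((ℓ + 1) * Mh) hM), (0 : ℝ) < ((((ℓ + 1 : ℕ) : ℝ)) ^ (c.1.1 : ℕ) * ((((ℓ + 1 : ℕ) : ℝ))⁻¹) ^ (K - n)) := fun c => by positivity
  have hu0 : ∀ c, 0 ≤ u c := fun c => (mul_nonneg hη3 (inv_pos.2 (hlam c)).le).trans (hu c)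
  have hw1 : ∀ b, 0 < w 1 b := fun b => by
    rw [hw 1 b]
    exact pow_pos (mul_pos (pow_pos hL0 _) (pow_pos (inv_pos.2 hL0) _)) 1
  have hC₂0 : (0 : ℝ) ≤ (64 * ((ℓ + 1 : ℕ) : ℝ) / (16 * 3800 * (((((PV 2 ℓ m K hd3 hL)).d + 2) * ((PV 2 ℓ m K hd3 hL)).L : ℕ) : ℝ) ^ 2 * ((ℓ + 1 : ℕ) : ℝ))⁻¹) := by positivity
  have hCP2 : 0 ≤ 2 * CP := by positivity
  have hC₃' : (0 : ℝ) ≤ C₃ * (1 + 4 * BH * (64 * ((ℓ + 1 : ℕ) : ℝ) / (16 * 3800 * (((((PV 2 ℓ m K hd3 hL)).d + 2) * ((PV 2 ℓ m K hd3 hL)).L : ℕ) : ℝ) ^ 2 * ((ℓ + 1 : ℕ) : ℝ))⁻¹) * ε) := by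
    have : (0 : ℝ) ≤ 4 * BH * (64 * ((ℓ + 1 : ℕ) : ℝ) / (16 * 3800 * (((((PV 2 ℓ m K hd3 hL)).d + 2) * ((PV 2 ℓ m K hd3 hL)).L : ℕ) : ℝ) ^ 2 * ((ℓ + 1 : ℕ) : ℝ))⁻¹) * ε := by positivity
    exact mul_nonneg hC₃ (by linarith)
  -- `Hs` of record: P2's first row-list entry at the datum, the scaled extension with its `fderiv` right-inverse identity
  have hsup : HSupLetterG (⟨ℓ + 1, hL, m, hm⟩ : T3Family) n K (cubeSeqMT3 (⟨ℓ + 1, hL, m, hm⟩ : T3Family) n K x₀ ρ S ((ℓ + 1) * Mh) hM) w (flatH (⟨ℓ + 1, hL, m, hm⟩ : T3Family) n K (cubeSeqMT3 (⟨ℓ + 1, hL, m, hm⟩ : T3Family) n K x₀ ρ S ((ℓ + 1) * Mh) hM)) C :=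
    hrows m hm n K hk1 hk' hMha hMh₃ hR₃ (cubeSeqMT3 (⟨ℓ + 1, hL, m, hm⟩ : T3Family) n K x₀ ρ S ((ℓ + 1) * Mh) hM) hDk hAdm w hw
  obtain ⟨Hs, hHS, hHinv, -, -⟩ := exists_flatH_scaledExt_hHinv (⟨ℓ + 1, hL, m, hm⟩ : T3Family) n K (cubeSeqMT3 (⟨ℓ + 1, hL, m, hm⟩ : T3Family) n K x₀ ρ S ((ℓ + 1) * Mh) hM) w hw hsup
  -- the four H-side letters at `Hs`
  obtain ⟨hH, -, hHcol, hCH⟩ := hletters m hm n K hk1 hk' hMha hMh₁ hR₁ (cubeSeqMT3 (⟨ℓ + 1, hL, m, hm⟩ : T3Family) n K x₀ ρ S ((ℓ + 1) * Mh) hM) hDk hAdm w hw Hs hHS u hu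
  have hX1 := hx1 m hm n K hk1 hk' hMha hMh₂ hR₂ (cubeSeqMT3 (⟨ℓ + 1, hL, m, hm⟩ : T3Family) n K x₀ ρ S ((ℓ + 1) * Mh) hM) hDk hAdm w hw Hs hHS
  -- the chart of record: (S3) B3's differentiability and quadratic remainder below `Rs/4`
  obtain ⟨hΦd, hΦq⟩ := chartRemainderFlat_hCd_hCq_B1 (⟨ℓ + 1, hL, m, hm⟩ : T3Family) n K hRL hM (cubeSeqMT3 (⟨ℓ + 1, hL, m, hm⟩ : T3Family) n K x₀ ρ S ((ℓ + 1) * Mh) hM) hDk hAdm hw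
  -- (S6): the analytic chart `Dsel` of the (49) fixed point, with (S3)'s constants in the displayed currency
  obtain ⟨Dsel, han, hfd, hpt, hD, h49, hDd, hCd, h73⟩ :=
    exists_analytic_chartD_of_remainder_T3 (⟨ℓ + 1, hL, m, hm⟩ : T3Family) n K hw1 (chartLogFlat (((((ℓ + 1 : ℕ) : ℝ))⁻¹) ^ (K - n)) (cubeSeqMT3 (⟨ℓ + 1, hL, m, hm⟩ : T3Family) n K x₀ ρ S ((ℓ + 1) * Mh) hM) : (PBond (PV 2 ℓ m K hd3 hL) 0 → Matrix (Fin 2) (Fin 2) ℂ) → BondIdx (cubeSeqMT3 (⟨ℓ + 1, hL, m, hm⟩ : T3Family) n K x₀ ρ S ((ℓ + 1) * Mh) hM) → Matrix (Fin 2) (Fin 2) ℂ) (fderiv ℂ (chartLogFlat (((((ℓ + 1 : ℕ) : ℝ))⁻¹) ^ (K - n)) (cubeSeqMT3 (⟨ℓ + 1, hL, m, hm⟩ : T3Family) n K x₀ ρ S ((ℓ + 1) * Mh) hM) : (PBond (PV 2 ℓ m K hd3 hL) 0 → Matrix (Fin 2) (Fin 2) ℂ) → BondIdx (cubeSeqMT3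 (⟨ℓ + 1, hL, m, hm⟩ : T3Family) n K x₀ ρ S ((ℓ + 1) * Mh) hM) → Matrix (Fin 2) (Fin 2) ℂ) 0) Hs
      (C₂ := (64 * ((ℓ + 1 : ℕ) : ℝ) / (16 * 3800 * (((((PV 2 ℓ m K hd3 hL)).d + 2) * ((PV 2 ℓ m K hd3 hL)).L : ℕ) : ℝ) ^ 2 * ((ℓ + 1 : ℕ) : ℝ))⁻¹)) (R := (16 * 3800 * (((((PV 2 ℓ m K hd3 hL)).d + 2) * ((PV 2 ℓ m K hd3 hL)).L : ℕ) : ℝ) ^ 2 * ((ℓ + 1 : ℕ) : ℝ))⁻¹ / 4) (B₀ := BH) (ε := ε)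
      hC₂0 hBH hΦd hΦq hHinv (fun X t _ hX b => (hH X t hX).1 b) hq h3ε hε
  -- (X2-C′) at the dressed point `Y − Hs (Dsel Y)` (§1)
  have hCcolC := hCcol_at_dressedPoint (w 1) (w 3) hw1 (⟨x₀, 0⟩ : PBond (PV 2 ℓ m K hd3 hL) 0) u Hs Dsel
    (fun Z δ : PBond (PV 2 ℓ m K hd3 hL) 0 → Matrix (Fin 2) (Fin 2) ℂ =>
      fderiv ℂ (fun A : PBond ((⟨ℓ + 1, hL, m, hm⟩ : T3Family).P K) 0 → Matrix (Fin 2) (Fin 2) ℂ => chartLogFlat (((((ℓ + 1 : ℕ) : ℝ))⁻¹) ^ (K - n)) (cubeSeqMT3 (⟨ℓ + 1, hL, m, hm⟩ : T3Family) n K x₀ ρ S ((ℓ + 1) * Mh) hM) A - fderiv ℂ (chartLogFlat (((((ℓ + 1 : ℕ) : ℝ))⁻¹) ^ (K - n)) (cubeSeqMT3 (⟨ℓ + 1, hL, m, hm⟩ : T3Family) n K x₀ ρ S ((ℓ + 1) * Mh) hM) : (PBond (PV 2 ℓ m K hd3 hL) 0 → Matrix (Fin 2) (Fin 2) ℂ)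 → BondIdx (cubeSeqMT3 (⟨ℓ + 1, hL, m, hm⟩ : T3Family) n K x₀ ρ S ((ℓ + 1) * Mh) hM) → Matrix (Fin 2) (Fin 2) ℂ) 0 A) Z δ)
    (fun (Y : PBond (PV 2 ℓ m K hd3 hL) 0 → Matrix (Fin 2) (Fin 2) ℂ) (r : ℝ) =>
      ∀ (b : PBond (PV 2 ℓ m K hd3 hL) 0) (ν : Fin 3), w 2 b * ((ℓ + 1 : ℕ) : ℝ) ^ (K - n) * ‖Y ⟨b.src.shift ν, b.dir⟩ - Y b‖ ≤ r)
    hBH hC₂0 (fun X t hX => (hH X t hX).1) hD hCcol hR'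
  -- FILE C at `H := Hs`, `D := Dsel`, `C := C♭`, every letter discharged but (X2-C′)♭ and the numerics
  obtain ⟨W₀, hgrad, hW₀d, hfin⟩ := exists_hWq_dressed_cubeSeq_T3_of_columnLetters (⟨ℓ + 1, hL, m, hm⟩ : T3Family) n K x₀ ρ S ((ℓ + 1) * Mh) hM hS hw u hu0 Hs
    (fun Z : PBond ((⟨ℓ + 1, hL, m, hm⟩ : T3Family).P K) 0 → Matrix (Fin 2) (Fin 2) ℂ => chartLogFlat (((((ℓ + 1 : ℕ) : ℝ))⁻¹) ^ (K - n)) (cubeSeqMT3 (⟨ℓ + 1, hL, m, hm⟩ : T3Family) n K x₀ ρ S ((ℓ + 1) * Mh) hM) Z - fderiv ℂ (chartLogFlat (((((ℓ + 1 : ℕ) : ℝ))⁻¹) ^ (K - n)) (cubeSeqMT3 (⟨ℓ + 1, hL, m, hm⟩ : T3Family) n K x₀ ρ S ((ℓ + 1) * Mh) hM) : (PBond (PV 2 ℓ m K hd3 hL) 0 → Matrix (Fin 2) (Fin 2) ℂ) → BondIdx (cubeSeqMT3 (⟨ℓ + 1, hL, m, hm⟩ : T3Family) n K x₀ ρ S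 ((ℓ + 1) * Mh) hM) → Matrix (Fin 2) (Fin 2) ℂ) 0 Z) Dsel
    hH hD hX1 h49 hDd hCd hCcolC hHcol hCH hsmall hC₃' hK₀ hCP2 hC₂0 hBH hR₀0 hR₀ ha₃ hθ
  exact ⟨Hs, Dsel, W₀, hHS, hHinv, hH, han, hfd, hpt, hD, h49, hDd, hCd, h73, hgrad, hW₀d, hfin⟩

/-! ## §2 FILE E v2, all torus sizes -/

-- heartbeat budget (HOME README rule): FILE E-sized signature (> 100 lines); budgeted 400k on this declaration only
set_option maxHeartbeats 400000 in
/-- ★★★ **THE C_E KNIT ON THE CHART OF RECORD FROM THE (157)♭ READ-KERNEL ROW ALONE, ALL TORUS SIZES** (α7 twin of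
✓`exists_hWq_dressed_cubeSeq_T3_chartOfRecord_ofKernelRow`: binder `a′ + 3 ≤ m + n` deleted): FILE E's window supplied by ✓`exists_CE_window`, its (X2-C′)♭
ball letter read from `hKball` by ✓`hCcolFlatBall_of_readKernel157`; member-uniform `a₃(L, C₃, R′) > 0`.
[cite: Balaban1985Variational, (44)-(50) p.285, (55) p.286, (72)-(73) p.289, (80)-(89) pp.290-291, Prop. 4 (97)-(98) pp.292-293, (144) p.300, (152)-(158) pp.301-302, (161)-(163) p.303; Balaban1985Averaging, Prop. 5 (157) p.42] -/
theorem exists_hWq_dressed_cubeSeq_T3_chartOfRecord_ofKernelRow_allSizes (ℓ : ℕ) (hL : Odd (ℓ + 1) ∧ 1 < ℓ + 1) (hℓ : 4 ≤ ℓ) :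
    ∃ (Mh₀ R₀ : ℕ) (BH CX K₀ CP : ℝ), 0 ≤ BH ∧ 0 ≤ CX ∧ 0 ≤ K₀ ∧ 0 ≤ CP ∧
    ∀ (C₃ R' : ℝ), 0 ≤ C₃ → 0 < R' → R' ≤ (16 * 3800 * ((((2 + 1 + 2) * (ℓ + 1) : ℕ)) : ℝ) ^ 2 * ((ℓ + 1 : ℕ) : ℝ))⁻¹ / 4 → ∃ (ε Rc₀ a₃ : ℝ), 0 < a₃ ∧ a₃ ≤ Rc₀ ∧ Rc₀ < ε ∧
      3 * ε ≤ (16 * 3800 * ((((2 + 1 + 2) * (ℓ + 1) : ℕ)) : ℝ) ^ 2 * ((ℓ + 1 : ℕ) : ℝ))⁻¹ / 4 ∧ 9 * (64 * ((ℓ + 1 : ℕ) : ℝ) / (16 * 3800 * ((((2 + 1 + 2) * (ℓ + 1) : ℕ)) : ℝ) ^ 2 * ((ℓ + 1 : ℕ) : ℝ))⁻¹) * BH * ε < 1 ∧ (1 + 4 * BH * (64 * ((ℓ + 1 : ℕ) : ℝ) / (16 * 3800 * ((((2 + 1 + 2) * (ℓ + 1) : ℕ)) : ℝ) ^ 2 *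 ((ℓ + 1 : ℕ) : ℝ))⁻¹) * ε) * ε ≤ R' ∧
      (1 + 4 * BH * (64 * ((ℓ + 1 : ℕ) : ℝ) / (16 * 3800 * ((((2 + 1 + 2) * (ℓ + 1) : ℕ)) : ℝ) ^ 2 * ((ℓ + 1 : ℕ) : ℝ))⁻¹) * Rc₀) * a₃ ≤ 1 / (2 * ((ℓ + 1 : ℕ) : ℝ)) ∧
    ∀ (m : ℕ) (hm : 1 ≤ m) (n K : ℕ) (_ : 1 ≤ K - n) (_ : K - n + 1 ≤ m + K) {Mh R a' : ℕ} (_ : Mh = (ℓ + 1) ^ a') (_ : Mh₀ ≤ Mh) (_ : R₀ ≤ R)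
      (x₀ : Site (PV 2 ℓ m K hd3 hL) 0) (ρ S : ℕ) (hM : 1 ≤ (ℓ + 1) * Mh) (_ : R * ((ℓ + 1) * Mh) ≤ S)
      (w : ℕ → PBond (PV 2 ℓ m K hd3 hL) 0 → ℝ) (_ : IsLevWeight (⟨ℓ + 1, hL, m, hm⟩ : T3Family) n K (cubeSeqMT3 (⟨ℓ + 1, hL, m, hm⟩ : T3Family) n K x₀ ρ S ((ℓ + 1) * Mh) hM) w)
      (_ : ∀ (Z : PBond (PV 2 ℓ m K hd3 hL) 0 → Matrix (Fin 2) (Fin 2) ℂ) (ρ' : ℝ), 0 ≤ ρ' → ρ' < R' → (∀ b, w 1 b * ‖Z b‖ ≤ ρ') →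
        ∀ (b : PBond (PV 2 ℓ m K hd3 hL) 0) (M : Matrix (Fin 2) (Fin 2) ℂ) (i : BondIdx (cubeSeqMT3 (⟨ℓ + 1, hL, m, hm⟩ : T3Family) n K x₀ ρ S ((ℓ + 1) * Mh) hM)),
        ((iterBlockOf (i.1.1 : ℕ) b.src = i.1.2.src ∨ iterBlockOf (i.1.1 : ℕ) b.src = i.1.2.tgt) ∧
          (iterBlockOf (i.1.1 : ℕ) b.tgt = i.1.2.src ∨ iterBlockOf (i.1.1 : ℕ) b.tgt = i.1.2.tgt)) →
        ‖fderiv ℂ (fun A : PBond (PV 2 ℓ m K hd3 hL) 0 → Matrix (Fin 2) (Fin 2) ℂ => chartLogFlat (((((ℓ + 1 : ℕ) : ℝ))⁻¹) ^ (K - n)) (cubeSeqMT3 (⟨ℓ + 1, hL, m, hm⟩ : T3Family) n K x₀ ρ S ((ℓ + 1) * Mh) hM) A - fderiv ℂ (chartLogFlat (((((ℓ + 1 : ℕ) : ℝ))⁻¹) ^ (K - n)) (cubeSeqMT3 (⟨ℓ + 1, hL, m, hm⟩ : T3Family) n K x₀ ρ S ((ℓ + 1) * Mh) hM) : (PBond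 (PV 2 ℓ m K hd3 hL) 0 → Matrix (Fin 2) (Fin 2) ℂ) → BondIdx (cubeSeqMT3 (⟨ℓ + 1, hL, m, hm⟩ : T3Family) n K x₀ ρ S ((ℓ + 1) * Mh) hM) → Matrix (Fin 2) (Fin 2) ℂ) 0 A) Z (Pi.single b M) i‖ ≤
          C₃ * ρ' * (((((ℓ + 1 : ℕ) : ℝ))⁻¹) ^ (K - n)) * (((((ℓ + 1 : ℕ) : ℝ)) ^ (i.1.1 : ℕ))⁻¹) ^ 2 * ‖M‖),
    ∃ (Hs : (BondIdx (cubeSeqMT3 (⟨ℓ + 1, hL, m, hm⟩ : T3Family) n K x₀ ρ S ((ℓ + 1) * Mh) hM) → Matrix (Fin 2) (Fin 2) ℂ) →ₗ[ℂ] (PBond (PV 2 ℓ m K hd3 hL) 0 → Matrix (Fin 2) (Fin 2) ℂ))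
      (Dsel : (PBond (PV 2 ℓ m K hd3 hL) 0 → Matrix (Fin 2) (Fin 2) ℂ) → BondIdx (cubeSeqMT3 (⟨ℓ + 1, hL, m, hm⟩ : T3Family) n K x₀ ρ S ((ℓ + 1) * Mh) hM) → Matrix (Fin 2) (Fin 2) ℂ)
      (W₀ : (PBond (PV 2 ℓ m K hd3 hL) 0 → Matrix (Fin 2) (Fin 2) ℂ) → (PBond (PV 2 ℓ m K hd3 hL) 0 → Matrix (Fin 2) (Fin 2) ℂ)),
      (∀ (X : BondIdx (cubeSeqMT3 (⟨ℓ + 1, hL, m, hm⟩ : T3Family) n K x₀ ρ S ((ℓ + 1) * Mh) hM) → Matrix (Fin 2) (Fin 2) ℂ) (b : PBond (PV 2 ℓ m K hd3 hL) 0),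
        Hs X b = ∑ c : BondIdx (cubeSeqMT3 (⟨ℓ + 1, hL, m, hm⟩ : T3Family) n K x₀ ρ S ((ℓ + 1) * Mh) hM), (flatH (⟨ℓ + 1, hL, m, hm⟩ : T3Family) n K (cubeSeqMT3 (⟨ℓ + 1, hL, m, hm⟩ : T3Family) n K x₀ ρ S ((ℓ + 1) * Mh) hM) (Pi.single c 1) b * ((((ℓ + 1 : ℕ) : ℝ)) ^ (c.1.1 : ℕ) * ((((ℓ + 1 : ℕ) : ℝ))⁻¹) ^ (K - n))⁻¹) • X c) ∧
      (∀ X : BondIdx (cubeSeqMT3 (⟨ℓ + 1, hL, m, hm⟩ : T3Family) n K x₀ ρ S ((ℓ + 1) * Mh) hM) → Matrix (Fin 2) (Fin 2) ℂ, (fderiv ℂ (chartLogFlat (((((ℓ + 1 : ℕ) : ℝ))⁻¹) ^ (K - n)) (cubeSeqMT3 (⟨ℓ + 1, hL, m, hm⟩ : T3Family) n K x₀ ρ S ((ℓ + 1) * Mh) hM) : (PBond (PV 2 ℓ m K hd3 hL) 0 → Matrix (Fin 2) (Fin 2) ℂ) → BondIdx (cubeSeqMT3 (⟨ℓ + 1,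 hL, m, hm⟩ : T3Family) n K x₀ ρ S ((ℓ + 1) * Mh) hM) → Matrix (Fin 2) (Fin 2) ℂ) 0) (Hs X) = X) ∧
      (∀ (X : BondIdx (cubeSeqMT3 (⟨ℓ + 1, hL, m, hm⟩ : T3Family) n K x₀ ρ S ((ℓ + 1) * Mh) hM) → Matrix (Fin 2) (Fin 2) ℂ) (t : ℝ), (∀ c, ‖X c‖ ≤ t) →
        (∀ b, w 1 b * ‖Hs X b‖ ≤ BH * t) ∧
        ∀ (b : PBond (PV 2 ℓ m K hd3 hL) 0) (ν : Fin 3), w 2 b * ((ℓ + 1 : ℕ) : ℝ) ^ (K - n) * ‖Hs X ⟨b.src.shift ν, b.dir⟩ - Hs X b‖ ≤ BH * t) ∧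
      AnalyticOnNhd ℂ Dsel {A' : PBond (PV 2 ℓ m K hd3 hL) 0 → Matrix (Fin 2) (Fin 2) ℂ | ∀ b, w 1 b * ‖A' b‖ < ε} ∧
      DifferentiableOn ℂ (fderiv ℂ Dsel) {A' : PBond (PV 2 ℓ m K hd3 hL) 0 → Matrix (Fin 2) (Fin 2) ℂ | ∀ b, w 1 b * ‖A' b‖ < ε} ∧
      (∀ A' : PBond (PV 2 ℓ m K hd3 hL) 0 → Matrix (Fin 2) (Fin 2) ℂ, (∀ b, w 1 b * ‖A' b‖ < ε) →
        (∀ c, ‖Dsel A' c‖ ≤ 4 * (64 * ((ℓ + 1 : ℕ) : ℝ) / (16 * 3800 * (((((PV 2 ℓ m K hd3 hL)).d + 2) * ((PV 2 ℓ m K hd3 hL)).L : ℕ) : ℝ) ^ 2 * ((ℓ + 1 : ℕ) : ℝ))⁻¹) * ε ^ 2) ∧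
        chartLogFlat (((((ℓ + 1 : ℕ) : ℝ))⁻¹) ^ (K - n)) (cubeSeqMT3 (⟨ℓ + 1, hL, m, hm⟩ : T3Family) n K x₀ ρ S ((ℓ + 1) * Mh) hM) (A' - Hs (Dsel A')) - (fderiv ℂ (chartLogFlat (((((ℓ + 1 : ℕ) : ℝ))⁻¹) ^ (K - n)) (cubeSeqMT3 (⟨ℓ + 1, hL, m, hm⟩ : T3Family) n K x₀ ρ S ((ℓ + 1) * Mh) hM) : (PBond (PV 2 ℓ m K hd3 hL) 0 → Matrix (Fin 2) (Fin 2) ℂ) → BondIdx (cubeSeqMT3 (⟨ℓ + 1, hL, m, hm⟩ : T3Family) n K x₀ ρ S ((ℓ + 1) * Mh) hM) → Matrix (Fin 2) (Fin 2) ℂ) 0) (A' - Hs (Dsel A')) = Dsel A' ∧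
        chartLogFlat (((((ℓ + 1 : ℕ) : ℝ))⁻¹) ^ (K - n)) (cubeSeqMT3 (⟨ℓ + 1, hL, m, hm⟩ : T3Family) n K x₀ ρ S ((ℓ + 1) * Mh) hM) (A' - Hs (Dsel A')) = (fderiv ℂ (chartLogFlat (((((ℓ + 1 : ℕ) : ℝ))⁻¹) ^ (K - n)) (cubeSeqMT3 (⟨ℓ + 1, hL, m, hm⟩ : T3Family) n K x₀ ρ S ((ℓ + 1) * Mh) hM) : (PBond (PV 2 ℓ m K hd3 hL) 0 → Matrix (Fin 2) (Fin 2) ℂ) → BondIdx (cubeSeqMT3 (⟨ℓ + 1, hL, m, hm⟩ : T3Family) n K x₀ ρ S ((ℓ + 1) * Mh) hM) → Matrix (Fin 2) (Fin 2) ℂ) 0) A' ∧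
        (∀ D' : BondIdx (cubeSeqMT3 (⟨ℓ + 1, hL, m, hm⟩ : T3Family) n K x₀ ρ S ((ℓ + 1) * Mh) hM) → Matrix (Fin 2) (Fin 2) ℂ, (∀ c, ‖D' c‖ ≤ 4 * (64 * ((ℓ + 1 : ℕ) : ℝ) / (16 * 3800 * (((((PV 2 ℓ m K hd3 hL)).d + 2) * ((PV 2 ℓ m K hd3 hL)).L : ℕ) : ℝ) ^ 2 * ((ℓ + 1 : ℕ) : ℝ))⁻¹) * ε ^ 2) →
          chartLogFlat (((((ℓ + 1 : ℕ) : ℝ))⁻¹) ^ (K - n)) (cubeSeqMT3 (⟨ℓ + 1, hL, m, hm⟩ : T3Family) n K x₀ ρ S ((ℓ + 1) * Mh) hM) (A' - Hs D') - (fderiv ℂ (chartLogFlat (((((ℓ + 1 : ℕ) : ℝ))⁻¹) ^ (K - n)) (cubeSeqMT3 (⟨ℓ + 1, hL, m, hm⟩ : T3Family) n K x₀ ρ S ((ℓ + 1) * Mh) hM) : (PBond (PV 2 ℓ m K hd3 hL) 0 → Matrix (Fin 2) (Fin 2) ℂ) → BondIdx (cubeSeqMT3 (⟨ℓ + 1,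 hL, m, hm⟩ : T3Family) n K x₀ ρ S ((ℓ + 1) * Mh) hM) → Matrix (Fin 2) (Fin 2) ℂ) 0) (A' - Hs D') = D' → D' = Dsel A') ∧
        (∀ ρ' : ℝ, 0 ≤ ρ' → (∀ b, w 1 b * ‖A' b‖ ≤ ρ') → ∀ c, ‖Dsel A' c‖ ≤ 4 * (64 * ((ℓ + 1 : ℕ) : ℝ) / (16 * 3800 * (((((PV 2 ℓ m K hd3 hL)).d + 2) * ((PV 2 ℓ m K hd3 hL)).L : ℕ) : ℝ) ^ 2 * ((ℓ + 1 : ℕ) : ℝ))⁻¹) * ρ' ^ 2)) ∧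
      (∀ (Y : PBond (PV 2 ℓ m K hd3 hL) 0 → Matrix (Fin 2) (Fin 2) ℂ) (r : ℝ), r < ε → (∀ b, w 1 b * ‖Y b‖ ≤ r) → (∀ (b : PBond (PV 2 ℓ m K hd3 hL) 0) (ν : Fin 3), w 2 b * ((ℓ + 1 : ℕ) : ℝ) ^ (K - n) * ‖Y ⟨b.src.shift ν, b.dir⟩ - Y b‖ ≤ r) →
        ∀ c, ‖Dsel Y c‖ ≤ 4 * (64 * ((ℓ + 1 : ℕ) : ℝ) / (16 * 3800 * (((((PV 2 ℓ m K hd3 hL)).d + 2) * ((PV 2 ℓ m K hd3 hL)).L : ℕ) : ℝ) ^ 2 * ((ℓ + 1 : ℕ) : ℝ))⁻¹) * r ^ 2) ∧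
      (∀ (Y : PBond (PV 2 ℓ m K hd3 hL) 0 → Matrix (Fin 2) (Fin 2) ℂ) (r : ℝ), r < ε → (∀ b, w 1 b * ‖Y b‖ ≤ r) → (∀ (b : PBond (PV 2 ℓ m K hd3 hL) 0) (ν : Fin 3), w 2 b * ((ℓ + 1 : ℕ) : ℝ) ^ (K - n) * ‖Y ⟨b.src.shift ν, b.dir⟩ - Y b‖ ≤ r) →
        ∀ᶠ X in 𝓝 Y, Dsel X = (fun Z : PBond (PV 2 ℓ m K hd3 hL) 0 → Matrix (Fin 2) (Fin 2) ℂ => chartLogFlat (((((ℓ + 1 : ℕ) : ℝ))⁻¹) ^ (K - n)) (cubeSeqMT3 (⟨ℓ + 1, hL, m, hm⟩ : T3Family) n K x₀ ρ S ((ℓ + 1) * Mh) hM) Z - fderiv ℂ (chartLogFlat (((((ℓ + 1 : ℕ) : ℝ))⁻¹) ^ (K - n)) (cubeSeqMT3 (⟨ℓ + 1, hL, m, hm⟩ : T3Family) n K x₀ ρ S ((ℓ + 1) * Mh) hM) : (PBond (PV 2 ℓ m K hd3 hL) 0 → Matrix (Fin 2) (Fin 2) ℂ) → BondIdx (cubeSeqMT3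 (⟨ℓ + 1, hL, m, hm⟩ : T3Family) n K x₀ ρ S ((ℓ + 1) * Mh) hM) → Matrix (Fin 2) (Fin 2) ℂ) 0 Z) (X - Hs (Dsel X))) ∧
      (∀ (Y : PBond (PV 2 ℓ m K hd3 hL) 0 → Matrix (Fin 2) (Fin 2) ℂ) (r : ℝ), r < ε → (∀ b, w 1 b * ‖Y b‖ ≤ r) → (∀ (b : PBond (PV 2 ℓ m K hd3 hL) 0) (ν : Fin 3), w 2 b * ((ℓ + 1 : ℕ) : ℝ) ^ (K - n) * ‖Y ⟨b.src.shift ν, b.dir⟩ - Y b‖ ≤ r) →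
        DifferentiableAt ℂ Dsel Y) ∧
      (∀ (Y : PBond (PV 2 ℓ m K hd3 hL) 0 → Matrix (Fin 2) (Fin 2) ℂ) (r : ℝ), r < ε → (∀ b, w 1 b * ‖Y b‖ ≤ r) → (∀ (b : PBond (PV 2 ℓ m K hd3 hL) 0) (ν : Fin 3), w 2 b * ((ℓ + 1 : ℕ) : ℝ) ^ (K - n) * ‖Y ⟨b.src.shift ν, b.dir⟩ - Y b‖ ≤ r) →
        DifferentiableAt ℂ (fun Z : PBond (PV 2 ℓ m K hd3 hL) 0 → Matrix (Fin 2) (Fin 2) ℂ => chartLogFlat (((((ℓ + 1 : ℕ) : ℝ))⁻¹) ^ (K - n)) (cubeSeqMT3 (⟨ℓ + 1, hL, m, hm⟩ : T3Family) n K x₀ ρ S ((ℓ + 1) * Mh) hM) Z - fderiv ℂ (chartLogFlat (((((ℓ + 1 : ℕ) : ℝ))⁻¹) ^ (K - n)) (cubeSeqMT3 (⟨ℓ + 1, hL, m, hm⟩ : T3Family) n K x₀ ρ S ((ℓ + 1) * Mh) hM) : (PBond (PV 2 ℓ m K hd3 hL) 0 → Matrix (Fin 2) (Fin 2) ℂ)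 → BondIdx (cubeSeqMT3 (⟨ℓ + 1, hL, m, hm⟩ : T3Family) n K x₀ ρ S ((ℓ + 1) * Mh) hM) → Matrix (Fin 2) (Fin 2) ℂ) 0 Z) (Y - Hs (Dsel Y))) ∧
      (∀ A' : PBond (PV 2 ℓ m K hd3 hL) 0 → Matrix (Fin 2) (Fin 2) ℂ, (∀ b, w 1 b * ‖A' b‖ < ε) → ∀ ρ' : ℝ, 0 ≤ ρ' → (∀ b, w 1 b * ‖A' b‖ ≤ ρ') →
        ∀ (W : PBond (PV 2 ℓ m K hd3 hL) 0 → Matrix (Fin 2) (Fin 2) ℂ) (t : ℝ), 0 ≤ t → (∀ b, w 1 b * ‖W b‖ ≤ t) →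
          ∀ c, ‖fderiv ℂ Dsel A' W c‖ ≤ 9 * (64 * ((ℓ + 1 : ℕ) : ℝ) / (16 * 3800 * (((((PV 2 ℓ m K hd3 hL)).d + 2) * ((PV 2 ℓ m K hd3 hL)).L : ℕ) : ℝ) ^ 2 * ((ℓ + 1 : ℕ) : ℝ))⁻¹) * ρ' * (1 - 9 * (64 * ((ℓ + 1 : ℕ) : ℝ) / (16 * 3800 * (((((PV 2 ℓ m K hd3 hL)).d + 2) * ((PV 2 ℓ m K hd3 hL)).L : ℕ) : ℝ) ^ 2 * ((ℓ + 1 : ℕ) : ℝ))⁻¹) * BH * ε)⁻¹ * t) ∧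
      (∀ A δ : PBond (PV 2 ℓ m K hd3 hL) 0 → Matrix (Fin 2) (Fin 2) ℂ, fderiv ℂ (fun A : PBond (PV 2 ℓ m K hd3 hL) 0 → Matrix (Fin 2) (Fin 2) ℂ => (∑ p : Plaq (PV 2 ℓ m K hd3 hL) 0, (1 - (2 : ℂ)⁻¹ * Matrix.trace (exp ((Complex.I * ((((((ℓ + 1 : ℕ) : ℝ)⁻¹) ^ (K - n) : ℝ)) : ℂ)) • A ⟨p.src, p.μ⟩) * exp ((Complex.I * ((((((ℓ + 1 : ℕ) : ℝ)⁻¹) ^ (K - n) : ℝ)) : ℂ)) • A ⟨p.src.shift p.μ, p.ν⟩) * exp (-((Complex.I * ((((((ℓ + 1 : ℕ) : ℝ)⁻¹) ^ (K - n) : ℝ)) : ℂ)) • A ⟨p.src.shift p.ν, p.μ⟩)) * exp (-((Complex.I * ((((((ℓ + 1 : ℕ) : ℝ)⁻¹) ^ (K - n) : ℝ)) : ℂ)) • A ⟨p.src, p.ν⟩))) + (2 : ℂ)⁻¹ * Matrix.trace (((Complex.I * ((((((ℓ + 1 : ℕ) : ℝ)⁻¹) ^ (K - n) : ℝ)) :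 ℂ)) • A ⟨p.src, p.μ⟩) + ((Complex.I * ((((((ℓ + 1 : ℕ) : ℝ)⁻¹) ^ (K - n) : ℝ)) : ℂ)) • A ⟨p.src.shift p.μ, p.ν⟩) + (-((Complex.I * ((((((ℓ + 1 : ℕ) : ℝ)⁻¹) ^ (K - n) : ℝ)) : ℂ)) • A ⟨p.src.shift p.ν, p.μ⟩)) + (-((Complex.I * ((((((ℓ + 1 : ℕ) : ℝ)⁻¹) ^ (K - n) : ℝ)) : ℂ)) • A ⟨p.src, p.ν⟩))) + (4 : ℂ)⁻¹ * Matrix.trace ((((Complex.I * ((((((ℓ + 1 : ℕ) : ℝ)⁻¹) ^ (K - n) : ℝ)) : ℂ)) • A ⟨p.src, p.μ⟩) + ((Complex.I * ((((((ℓ + 1 : ℕ) : ℝ)⁻¹) ^ (K - n) : ℝ)) : ℂ)) • A ⟨p.src.shift p.μ, p.ν⟩) + (-((Complex.I * ((((((ℓ + 1 : ℕ) : ℝ)⁻¹) ^ (K - n) : ℝ)) : ℂ)) • A ⟨p.src.shift p.ν, p.μ⟩)) + (-((Complex.I * ((((((ℓ + 1 : ℕ) : ℝ)⁻¹) ^ (K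 - n) : ℝ)) : ℂ)) • A ⟨p.src, p.ν⟩))) ^ 2)))) A δ =
        (((((ℓ + 1 : ℕ) : ℝ)⁻¹) ^ (K - n) : ℝ) : ℂ) ^ 4 * ∑ b : PBond (PV 2 ℓ m K hd3 hL) 0, Matrix.trace (W₀ A b * δ b)) ∧
      Differentiable ℂ W₀ ∧
      ∀ E : (PBond (PV 2 ℓ m K hd3 hL) 0 → Matrix (Fin 2) (Fin 2) ℂ) → (PBond (PV 2 ℓ m K hd3 hL) 0 → Matrix (Fin 2) (Fin 2) ℂ),
        (∀ (Y : PBond (PV 2 ℓ m K hd3 hL) 0 → Matrix (Fin 2) (Fin 2) ℂ) (b : PBond (PV 2 ℓ m K hd3 hL) 0) (i j : Fin 2), E Y b i j = (((((((ℓ + 1 : ℕ) : ℝ)⁻¹) ^ (K - n)) : ℝ) : ℂ) ^ 4)⁻¹ *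
          (-((((((((ℓ + 1 : ℕ) : ℝ)⁻¹) ^ (K - n)) : ℝ) : ℂ) ^ 2 / 2) * ∑ p : Plaq (PV 2 ℓ m K hd3 hL) 0, Matrix.trace ((Hs (Dsel Y) ⟨p.src, p.μ⟩ + Hs (Dsel Y) ⟨p.src.shift p.μ, p.ν⟩ - Hs (Dsel Y) ⟨p.src.shift p.ν, p.μ⟩ - Hs (Dsel Y) ⟨p.src, p.ν⟩) *
              (((Pi.single b (Matrix.single j i (1 : ℂ)) : PBond (PV 2 ℓ m K hd3 hL) 0 → Matrix (Fin 2) (Fin 2) ℂ)) ⟨p.src, p.μ⟩ + ((Pi.single b (Matrix.single j i (1 : ℂ)) : PBond (PV 2 ℓ m K hd3 hL) 0 → Matrix (Fin 2) (Fin 2) ℂ)) ⟨p.src.shift p.μ, p.ν⟩ -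
                ((Pi.single b (Matrix.single j i (1 : ℂ)) : PBond (PV 2 ℓ m K hd3 hL) 0 → Matrix (Fin 2) (Fin 2) ℂ)) ⟨p.src.shift p.ν, p.μ⟩ - ((Pi.single b (Matrix.single j i (1 : ℂ)) : PBond (PV 2 ℓ m K hd3 hL) 0 → Matrix (Fin 2) (Fin 2) ℂ)) ⟨p.src, p.ν⟩)))
            - (((((((ℓ + 1 : ℕ) : ℝ)⁻¹) ^ (K - n)) : ℝ) : ℂ) ^ 2 / 2) * ∑ p : Plaq (PV 2 ℓ m K hd3 hL) 0, Matrix.trace (((Y - Hs (Dsel Y)) ⟨p.src, p.μ⟩ + (Y - Hs (Dsel Y)) ⟨p.src.shift p.μ, p.ν⟩ - (Y - Hs (Dsel Y)) ⟨p.src.shift p.ν, p.μ⟩ - (Y - Hs (Dsel Y)) ⟨p.src, p.ν⟩) *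
              (Hs (fderiv ℂ Dsel Y (Pi.single b (Matrix.single j i (1 : ℂ)))) ⟨p.src, p.μ⟩ + Hs (fderiv ℂ Dsel Y (Pi.single b (Matrix.single j i (1 : ℂ)))) ⟨p.src.shift p.μ, p.ν⟩ -
                Hs (fderiv ℂ Dsel Y (Pi.single b (Matrix.single j i (1 : ℂ)))) ⟨p.src.shift p.ν, p.μ⟩ - Hs (fderiv ℂ Dsel Y (Pi.single b (Matrix.single j i (1 : ℂ)))) ⟨p.src, p.ν⟩))
            - ((((((ℓ + 1 : ℕ) : ℝ)⁻¹) ^ (K - n)) : ℝ) : ℂ) ^ 4 * ∑ b' : PBond (PV 2 ℓ m K hd3 hL) 0, Matrix.trace (W₀ (Y - Hs (Dsel Y)) b' * Hs (fderiv ℂ Dsel Y (Pi.single b (Matrix.single j i (1 : ℂ)))) b'))) →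
        ∀ (Y : PBond (PV 2 ℓ m K hd3 hL) 0 → Matrix (Fin 2) (Fin 2) ℂ) (r : ℝ), r < a₃ → (∀ b, w 1 b * ‖Y b‖ ≤ r) →
          (∀ (b : PBond (PV 2 ℓ m K hd3 hL) 0) (ν : Fin 3), w 2 b * ((ℓ + 1 : ℕ) : ℝ) ^ (K - n) * ‖Y ⟨b.src.shift ν, b.dir⟩ - Y b‖ ≤ r) →
          ∀ b, w 3 b * ‖(W₀ (Y - Hs (Dsel Y)) + E Y) b‖ ≤
            (12 * (((ℓ + 1 : ℕ) : ℝ) ^ 3 * (1428 + ((ℓ + 1 : ℕ) : ℝ))) * (1 + 4 * BH * (64 * ((ℓ + 1 : ℕ) : ℝ) / (16 * 3800 * (((((PV 2 ℓ m K hd3 hL)).d + 2) * ((PV 2 ℓ m K hd3 hL)).L : ℕ) : ℝ) ^ 2 * ((ℓ + 1 : ℕ) : ℝ))⁻¹) * Rc₀) ^ 2 +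
              (2 * CX * (64 * ((ℓ + 1 : ℕ) : ℝ) / (16 * 3800 * (((((PV 2 ℓ m K hd3 hL)).d + 2) * ((PV 2 ℓ m K hd3 hL)).L : ℕ) : ℝ) ^ 2 * ((ℓ + 1 : ℕ) : ℝ))⁻¹) + 2⁻¹ * (8 * (7 * C₃ * (1 + 4 * BH * (64 * ((ℓ + 1 : ℕ) : ℝ) / (16 * 3800 * (((((PV 2 ℓ m K hd3 hL)).d + 2) * ((PV 2 ℓ m K hd3 hL)).L : ℕ) : ℝ) ^ 2 * ((ℓ + 1 : ℕ) : ℝ))⁻¹) * ε)) * (2 * CP)) * (1 + 4 * BH * (64 * ((ℓ + 1 : ℕ) : ℝ) / (16 * 3800 * (((((PV 2 ℓ m K hd3 hL)).d + 2) * ((PV 2 ℓ m K hd3 hL)).L : ℕ) : ℝ) ^ 2 * ((ℓ + 1 : ℕ) : ℝ))⁻¹) * Rc₀) +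
                (16 * K₀ * (7 * C₃ * (1 + 4 * BH * (64 * ((ℓ + 1 : ℕ) : ℝ) / (16 * 3800 * (((((PV 2 ℓ m K hd3 hL)).d + 2) * ((PV 2 ℓ m K hd3 hL)).L : ℕ) : ℝ) ^ 2 * ((ℓ + 1 : ℕ) : ℝ))⁻¹) * ε))) * Rc₀ * (12 * (((ℓ + 1 : ℕ) : ℝ) ^ 3 * (1428 + ((ℓ + 1 : ℕ) : ℝ)))) * (1 + 4 * BH * (64 * ((ℓ + 1 : ℕ) : ℝ) / (16 * 3800 * (((((PV 2 ℓ m K hd3 hL)).d + 2) * ((PV 2 ℓ m K hd3 hL)).L : ℕ) : ℝ) ^ 2 * ((ℓ + 1 : ℕ) : ℝ))⁻¹) * Rc₀) ^ 2)) * r ^ 2 := by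
  obtain ⟨Mh₀, R₀, BH, CX, K₀, CP, hBH, hCX, hK₀, hCP, hE⟩ := exists_hWq_dressed_cubeSeq_T3_chartOfRecord_allSizes ℓ hL hℓ
  refine ⟨Mh₀, max R₀ (2 * (ℓ + 1)), BH, CX, K₀, CP, hBH, hCX, hK₀, hCP, fun C₃ R' hC₃ hR'0 hR'le => ?_⟩
  -- (S3)'s constants at this `L`
  have hL0 : (0 : ℝ) < ((ℓ + 1 : ℕ) : ℝ) := by positivity
  have hC₂0 : (0 : ℝ) ≤ (64 * ((ℓ + 1 : ℕ) : ℝ) / (16 * 3800 * ((((2 + 1 + 2) * (ℓ + 1) : ℕ)) : ℝ) ^ 2 * ((ℓ + 1 : ℕ) : ℝ))⁻¹) := by positivity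
  obtain ⟨ε, Rc₀, a₃, ha₃, hε, h3ε, hq, hR', hsmall, hRc0, hRcε, ha₃R, hθ⟩ :=
    exists_CE_window (C₃ := 7 * C₃) hR'0 hR'le hC₂0 hBH hK₀ (by positivity) hL0
  refine ⟨ε, Rc₀, a₃, ha₃, ha₃R, hRcε, h3ε, hq, hR', hθ, ?_⟩
  intro m hm n K hk1 hk' Mh R a' hMha hMh hR x₀ ρ S hM hRS w hw hKball
  have hR₀ : R₀ ≤ R := le_trans (le_max_left _ _) hR
  have hR2L : 2 * (ℓ + 1) ≤ R := le_trans (le_max_right _ _) hR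
  have hAdm : Adm22 (cubeSeqMT3 (⟨ℓ + 1, hL, m, hm⟩ : T3Family) n K x₀ ρ S ((ℓ + 1) * Mh) hM) R ((ℓ + 1) * Mh) := adm22_cubeSeqMT3 (⟨ℓ + 1, hL, m, hm⟩ : T3Family) n K x₀ ρ hM hRS
  have hDk : (cubeSeqMT3 (⟨ℓ + 1, hL, m, hm⟩ : T3Family) n K x₀ ρ S ((ℓ + 1) * Mh) hM).k = K - n := cubeSeqMT3_k (⟨ℓ + 1, hL, m, hm⟩ : T3Family) n K x₀ ρ S ((ℓ + 1) * Mh) hM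
  have hRL : 2 * ((⟨ℓ + 1, hL, m, hm⟩ : T3Family).P K).L ≤ R := by
    show 2 * (ℓ + 1) ≤ R
    exact hR2L
  -- (S3) B3: the chart is differentiable on the `Rs/4`-ball; (S4) v1.2: the column letter on the ball from the read-kernel row
  obtain ⟨hdiff, -⟩ := chartRemainderFlat_hCd_hCq_B1 (⟨ℓ + 1, hL, m, hm⟩ : T3Family) n K hRL hM (cubeSeqMT3 (⟨ℓ + 1, hL, m, hm⟩ : T3Family) n K x₀ ρ S ((ℓ + 1) * Mh) hM) hDk hAdm hw
  have hball := hCcolFlatBall_of_readKernel157 (⟨ℓ + 1, hL, m, hm⟩ : T3Family) n K (cubeSeqMT3 (⟨ℓ + 1, hL, m, hm⟩ : T3Family) n K x₀ ρ S ((ℓ + 1) * Mh) hM) hDk hw (C₃ := C₃) (R := (16 * 3800 * (((((PV 2 ℓ m K hd3 hL)).d + 2) * ((PV 2 ℓ m K hd3 hL)).L : ℕ) : ℝ) ^ 2 * ((ℓ + 1 : ℕ) : ℝ))⁻¹ / 4) (R' := R')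
    hC₃ hR'le hdiff hKball
  have h7 : (0 : ℝ) ≤ 7 * C₃ := by positivity
  have hu : ∀ c : BondIdx (cubeSeqMT3 (⟨ℓ + 1, hL, m, hm⟩ : T3Family) n K x₀ ρ S ((ℓ + 1) * Mh) hM), ((((ℓ + 1 : ℕ) : ℝ)) ^ (K - n)) ^ 3 * ((((ℓ + 1 : ℕ) : ℝ)) ^ (c.1.1 : ℕ) * ((((ℓ + 1 : ℕ) : ℝ))⁻¹) ^ (K - n))⁻¹ ≤ (fun i : BondIdx (cubeSeqMT3 (⟨ℓ + 1, hL, m, hm⟩ : T3Family) n K x₀ ρ S ((ℓ + 1) * Mh) hM) => ((((((ℓ + 1 : ℕ) : ℝ))⁻¹) ^ (K - n)) ^ 3)⁻¹ * (((((ℓ + 1 : ℕ) : ℝ)) ^ (i.1.1 : ℕ) * ((((ℓ + 1 : ℕ) : ℝ))⁻¹) ^ (K - n)))⁻¹) c := fun c => by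
    show ((((ℓ + 1 : ℕ) : ℝ)) ^ (K - n)) ^ 3 * ((((ℓ + 1 : ℕ) : ℝ)) ^ (c.1.1 : ℕ) * ((((ℓ + 1 : ℕ) : ℝ))⁻¹) ^ (K - n))⁻¹ ≤ ((((((ℓ + 1 : ℕ) : ℝ))⁻¹) ^ (K - n)) ^ 3)⁻¹ * (((((ℓ + 1 : ℕ) : ℝ)) ^ (c.1.1 : ℕ) * ((((ℓ + 1 : ℕ) : ℝ))⁻¹) ^ (K - n)))⁻¹
    rw [inv_pow, inv_pow, inv_inv]
  exact hE m hm n K hk1 hk' hMha hMh hR₀ x₀ ρ S hM hRS w hw (fun i : BondIdx (cubeSeqMT3 (⟨ℓ + 1, hL, m, hm⟩ : T3Family) n K x₀ ρ S ((ℓ + 1) * Mh) hM) => ((((((ℓ + 1 : ℕ) : ℝ))⁻¹) ^ (K - n)) ^ 3)⁻¹ * (((((ℓ + 1 : ℕ) : ℝ)) ^ (i.1.1 : ℕ) * ((((ℓ + 1 : ℕ) : ℝ))⁻¹) ^ (K - n)))⁻¹) hu hε h3ε hq h7 hR' hball hsmall hRc0 hRcε ha₃R hθ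

end Summit.QuantumFields.YangMills.Theorems.HalvingDressingLetter

end
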